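import Summits.Ventures.GridStability.Models.PolynomialiseInfBus
import Mathlib.Analysis.Calculus.Deriv.Prod

/-!
# Recast curves in a finite-dimensional phase space (`Fin N → ℝ`) — glue for the -roa bridge

Venture GRIDFUSION, cell `run/shared/lean/pub/gridfusion/`, seat gridfusion-model-1. The recast lemmas
of `Polynomialise*.lean` speak of SOS points `ℕ → ℝ` (what `SOS.Poly.eval` consumes); the soundness
theorems of `Lyapunov/CertificateSoundness.lean` speak of curves in a normed phase space, concretely
`Fin N → ℝ`. This file is the (model-independent) glue:

* `ofFin y` — extend `y : Fin N → ℝ` by `0` to an SOS point; `restrictFin N z` — restrict;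
* `embed_eq_ofFin`, `embedRel_eq_ofFin` — the recast embeddings ARE such extensions (`N = 3n+1`, resp.
  `3n`), since they vanish beyond the last variable;
* `hasDerivWithinAt_restrict_embed` (+ `Rel`, `Inf`) — the `Fin N`-valued recast curve of a solution is
  differentiable with derivative `i ↦ f_i(z(t))` (vector form via `hasDerivWithinAt_pi`), i.e. it solves
  `y' = F y` with `F y i := (polyField.getD i []).eval (ofFin y)`.

With `V♯ y := V.eval (ofFin y)` the bridge hypotheses read: (4) from
`SOS.Poly.hasDerivWithinAt_eval_lieDeriv` on the `ℕ`-indexed curve (rewrite with `embed_eq_ofFin`),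
(5) from `eval_hcon`. MODELLED/CERTIFIED: nothing here.
-/

noncomputable section

open Real
open Literature.Computation.Certificates
open Literature.Computation.Certificates.SOS

namespace Summit.Ventures.GridStability.Models

/-- Extend a finite coordinate vector by zeros to an SOS point `ℕ → ℝ`. -/
def ofFin {N : ℕ} (y : Fin N → ℝ) (k : ℕ) : ℝ := if h : k < N then y ⟨k, h⟩ else 0

/-- Restrict an SOS point to its first `N` coordinates. -/
def restrictFin (N : ℕ) (z : ℕ → ℝ) : Fin N → ℝ := fun i => z i

/-- `ofFin (restrictFin N z) = z` as soon as `z` vanishes from index `N` on. -/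
theorem ofFin_restrictFin {N : ℕ} {z : ℕ → ℝ} (hz : ∀ k, N ≤ k → z k = 0) :
    ofFin (restrictFin N z) = z := by
  funext k
  unfold ofFin restrictFin
  split_ifs with h
  · rfl
  · exact (hz k (not_lt.1 h)).symm

/-- `ofFin y k = y k` below `N`. -/
@[simp] theorem ofFin_apply_lt {N : ℕ} (y : Fin N → ℝ) {k : ℕ} (h : k < N) : ofFin y k = y ⟨k, h⟩ := by
  simp [ofFin, h]

/-- `restrictFin` is evaluation. -/
@[simp] theorem restrictFin_apply (N : ℕ) (z : ℕ → ℝ) (i : Fin N) : restrictFin N z i = z i := rfl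

namespace RecastData

variable {n : ℕ} (d : RecastData n) (δs : Fin (n + 1) → ℝ) (x : ClassicalSwing.State (n + 1))

omit d in
/-- The absolute-speed embedding is the zero-extension of its first `3n+1` coordinates. -/
theorem embed_eq_ofFin : embed δs x = ofFin (restrictFin (3 * n + 1) (embed δs x)) :=
  (ofFin_restrictFin fun k hk => embed_high δs x (by omega)).symm

omit d in
/-- The relative / infinite-bus embedding is the zero-extension of its first `3n` coordinates. -/
theorem embedRel_eq_ofFin : embedRel δs x = ofFin (restrictFin (3 * n) (embedRel δs x)) :=
  (ofFin_restrictFin fun k hk => embedRel_high δs x (by omega)).symm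

variable {δs}

/-- **Vector form of the exact embedding lemma (absolute speeds).** Along a solution of `d.toModel`,
the phase-space curve `y τ := restrictFin (3n+1) (embed δ^s (c τ))` has derivative
`i ↦ f_i(ofFin (y t))` within `s` at `t`. -/
theorem hasDerivWithinAt_restrict_embed (h : d.EqData δs) (hM : ∀ i, d.M i ≠ 0)
    {c : ℝ → ClassicalSwing.State (n + 1)} {s : Set ℝ} (hc : d.toModel.IsSolutionOn c s)
    {t : ℝ} (ht : t ∈ s) :
    HasDerivWithinAt (fun τ => restrictFin (3 * n + 1) (embed δs (c τ)))
      (fun i : Fin (3 * n + 1) =>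
        (d.polyField.getD i []).eval (ofFin (restrictFin (3 * n + 1) (embed δs (c t))))) s t := by
  rw [← embed_eq_ofFin]
  exact hasDerivWithinAt_pi.2 fun i => d.hasDerivWithinAt_embed h hM hc ht i

/-- **Vector form, relative speeds** (`toModelRel λ a′`, `3n` coordinates). -/
theorem hasDerivWithinAt_restrict_embedRel (lam : ℚ) (h : d.EqData δs) (hM : ∀ i, d.M i ≠ 0) (a : ℝ)
    {c : ℝ → ClassicalSwing.State (n + 1)} {s : Set ℝ} (hc : (d.toModelRel lam a).IsSolutionOn c s)
    {t : ℝ} (ht : t ∈ s) :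
    HasDerivWithinAt (fun τ => restrictFin (3 * n) (embedRel δs (c τ)))
      (fun i : Fin (3 * n) =>
        ((d.relField lam).getD i []).eval (ofFin (restrictFin (3 * n) (embedRel δs (c t))))) s t := by
  rw [← embedRel_eq_ofFin]
  exact hasDerivWithinAt_pi.2 fun i => d.hasDerivWithinAt_embedRel lam h hM a hc ht i

/-- **Vector form, infinite bus** (`IsInfBusSolutionOn`, `3n` coordinates). -/
theorem hasDerivWithinAt_restrict_embedInf (h : d.EqData δs) (hM : ∀ i, d.M i ≠ 0) {δ₀ : ℝ}
    {c : ℝ → ClassicalSwing.State (n + 1)} {s : Set ℝ} (hc : d.IsInfBusSolutionOn δ₀ c s)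
    {t : ℝ} (ht : t ∈ s) :
    HasDerivWithinAt (fun τ => restrictFin (3 * n) (embedRel δs (c τ)))
      (fun i : Fin (3 * n) =>
        (d.infField.getD i []).eval (ofFin (restrictFin (3 * n) (embedRel δs (c t))))) s t := by
  rw [← embedRel_eq_ofFin]
  exact hasDerivWithinAt_pi.2 fun i => d.hasDerivWithinAt_embedInf h hM hc ht i

/-- A polynomial `V` read on the phase space `Fin (3n+1) → ℝ` agrees with `V.eval` on the embedding:
`V♯ (restrict (embed x)) = V.eval (embed x)`. -/
theorem eval_ofFin_restrict_embed (V : Poly) :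
    V.eval (ofFin (restrictFin (3 * n + 1) (embed δs x))) = V.eval (embed δs x) := by
  rw [← embed_eq_ofFin]

/-- Same for the relative / infinite-bus embedding (`3n` coordinates). -/
theorem eval_ofFin_restrict_embedRel (V : Poly) :
    V.eval (ofFin (restrictFin (3 * n) (embedRel δs x))) = V.eval (embedRel δs x) := by
  rw [← embedRel_eq_ofFin]

end RecastData

end Summit.Ventures.GridStability.Models
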